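/-
Copyright (c) 2026. All rights reserved.
Released under Apache 2.0 license as described in the file LICENSE.
Authors: abc-iut cell — seat abc-iut-w5-d053 (wave 5, gen 3; §4(iii) non-vacuity programme, NV-L4 rows
`AbsTopIII.NFPortionAlgorithm`, `AbsTopIII.FunctionFieldAlgorithm` of abc-iut-w5-d197's INHABITATION-CENSUS-L4-v1).
-/
import Mathlib.Algebra.Field.ULift
import Literature.AnabelianGeometry.AbsoluteAnabelian.AbsTopIII.Reconstruction
import Literature.AnabelianGeometry.AbsoluteAnabelian.AbsTopIII.BirationalReconstruction
import HarnessLib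

/-!
# Non-vacuity records for the [AbsTopIII] Thm 1.9 / Thm 1.11 ALGORITHM records

S. Mochizuki, *Topics in absolute anabelian geometry III: global reconstruction algorithms* [MochizukiAbsTopIII2015],
Thm 1.9 pp. 37–38 ("there exists a functorial 'group-theoretic' algorithm for reconstructing the 'NF-portion of the
function field'"), Thm 1.11 pp. 45–47 (the function field from `1 → Δ_{η_X} → Π_{η_X} → G_k → 1`), Rmk 1.9.8 p. 40
("the algorithm in question is phrased in language that only depends on the topological group structure").

abc-iut-L4-t1 typed each "functorial group-theoretic algorithm" as a RECORD (`NFPortionAlgorithm`,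
`FunctionFieldAlgorithm`: an output on EVERY abstract extension + transport along isomorphisms with `map_id` /
`map_comp` + contravariant `comap` along open injective homomorphisms inverting `map` on isomorphisms (+ `comapBase`
for Thm 1.9)), the printed theorems becoming `Thm_1_9 M` / `Thm_1_11` = "SOME such algorithm has the printed output on
the geometric inputs".  abc-iut-w5-d197's kernel INHABITATION-CENSUS-L4-v1 lists both records with ZERO producers (their
sibling `MLFReconstructionAlgorithm` is inhabited by abc-iut-L4-d3's `cor_1_10_i_holds`).  This PROOF-ONLY file records,
with honest labels:

* `NFPortionAlgorithm.nonempty` / `FunctionFieldAlgorithm.nonempty` (every universe): the CONSTANT algorithms — every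
  extension `E` is sent to one fixed output (`k̄_NF = K_{Z_NF} := ℚ` lifted to the universe, Kummer container `ℚ^×`
  with the identity Kummer map, no NF-points / no inertia groups recorded; for Thm 1.9 the index of Belyi
  cuspidalizations is the ONE trivial cuspidalization `(Y, U) = (X, X)` with `Π_U → Π_X` the identity — the only
  non-placeholder datum), `map :=` identities, `comap`/`comapBase :=` identities.  HONEST LABEL: DEGENERATE — these
  are NOT the reconstruction algorithms of Thm 1.9 / 1.11 (no anabelian content); they certify that the
  FUNCTORIALITY AXIOM PACKAGE of each record (`map_id`, `map_comp`, `comap_map`) is jointly satisfiable, so that the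
  named facts `Thm_1_9 M`, `Thm_1_11` carry their content in the COMPARISON clause, not in the existence of an
  algorithm object.
* `exists_nfPortionAlgorithm_coverHom_id`: the recorded non-placeholder datum — an algorithm whose Belyi
  cuspidalization index over every `E` is the trivial cover with `coverHom = 𝟙 E`.
* `exists_functionFieldAlgorithm_decomp_empty`: the constant Thm-1.11 algorithm records no inertia / decomposition
  groups (so it visibly does NOT satisfy any comparison clause asking for the decomposition groups of points).

Nothing of [AbsTopIII] is asserted to be proved; the genuine algorithms need étale `π₁` and the Kummer theory of
[AbsTopIII] §1 (FOUNDATIONS row 12); nothing here bears on the disputed [IUTchIII] Cor. 3.12.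
A witness is consistency evidence only; instantiated ≠ endorsed.
-/

noncomputable section

namespace Literature.AnabelianGeometry.AbsoluteAnabelian.AbsTopIII

open CategoryTheory

universe u

/-! ### Thm 1.9: `NFPortionAlgorithm` -/

/-- **The constant Thm-1.9 algorithm record** (DEGENERATE, see the module docstring): every extension `E` is sent to
the output with `k̄_NF = K_{Z_NF} := ℚ` (lifted), Kummer container `ℚ^×` with the identity Kummer map, no NF-point
decomposition groups recorded, and the ONE trivial Belyi cuspidalization `(X, X)` with `Π_U → Π_X := 𝟙`; transport
and the two contravariant functorialities are identities.  Certifies joint satisfiability of `map_id`, `map_comp`,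
`comap_map`. [cite: MochizukiAbsTopIII2015, Thm 1.9 p.37] -/
theorem exists_nfPortionAlgorithm_coverHom_id :
    ∃ A : NFPortionAlgorithm.{u}, ∀ E : FundamentalExtension.{u},
      (A.obj E).nfPointDecomp = ∅ ∧ Nonempty (Unique (A.obj E).Cover) ∧
        ∀ c : (A.obj E).Cover, (A.obj E).coverExt c = E ∧ HEq ((A.obj E).coverHom c) (𝟙 E) :=
  ⟨{ obj := fun E =>
       { nfPointDecomp := ∅
         Cover := PUnit.{u + 1}
         coverExt := fun _ => E
         coverHom := fun _ => 𝟙 E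
         constField := ULift.{u} ℚ
         functionField := ULift.{u} ℚ
         H1 := (ULift.{u} ℚ)ˣ
         kummer := MonoidHom.id _
         kummer_injective := fun _ _ h => h }
     map := fun _ => ⟨RingEquiv.refl _, RingEquiv.refl _, fun _ => rfl⟩
     map_id := fun _ => rfl
     map_comp := fun _ _ => rfl
     comap := fun _ _ => RingHom.id _
     comap_map := fun _ _ _ => rfl
     comapBase := fun _ _ => RingHom.id _ },
    fun _ => ⟨rfl, ⟨{ default := PUnit.unit, uniq := fun _ => rfl }⟩, fun _ => ⟨rfl, HEq.rfl⟩⟩⟩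

/-- `NFPortionAlgorithm` is inhabited in every universe (by the constant algorithm record).
[cite: MochizukiAbsTopIII2015, Thm 1.9 p.37] -/
theorem NFPortionAlgorithm.nonempty : Nonempty NFPortionAlgorithm.{u} :=
  let ⟨A, _⟩ := exists_nfPortionAlgorithm_coverHom_id.{u}
  ⟨A⟩

/-! ### Thm 1.11: `FunctionFieldAlgorithm` -/

/-- **The constant Thm-1.11 algorithm record** (DEGENERATE): every extension is sent to `k := ℚ ⊆ K_X := ℚ`
(lifted), Kummer container `ℚ^×` with the identity Kummer map, and NO inertia / decomposition subgroups (so the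
clause "`D_x` = normaliser of `I_x`" holds vacuously); transport and `comap` are identities.  Certifies joint
satisfiability of the record's functoriality axioms; it records no points, hence satisfies no comparison clause
about decomposition groups. [cite: MochizukiAbsTopIII2015, Thm 1.11 p.46] -/
theorem exists_functionFieldAlgorithm_decomp_empty :
    ∃ A : FunctionFieldAlgorithm.{u}, ∀ E : FundamentalExtension.{u},
      (A.obj E).inertiaSubgroups = ∅ ∧ (A.obj E).decompSubgroups = ∅ :=
  ⟨{ obj := fun _ =>
       { baseField := ULift.{u} ℚ
         functionField := ULift.{u} ℚ
         H1 := (ULift.{u} ℚ)ˣ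
         kummer := MonoidHom.id _
         kummer_injective := fun _ _ h => h
         inertiaSubgroups := ∅
         decompSubgroups := ∅
         decomp_eq := by
           ext D
           simp }
     map := fun _ => ⟨RingEquiv.refl _, RingEquiv.refl _, fun _ => rfl⟩
     map_id := fun _ => rfl
     map_comp := fun _ _ => rfl
     comap := fun _ _ => RingHom.id _
     comap_map := fun _ _ _ => rfl },
    fun _ => ⟨rfl, rfl⟩⟩

/-- `FunctionFieldAlgorithm` is inhabited in every universe (by the constant algorithm record).
[cite: MochizukiAbsTopIII2015, Thm 1.11 p.46] -/
theorem FunctionFieldAlgorithm.nonempty : Nonempty FunctionFieldAlgorithm.{u} :=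
  let ⟨A, _⟩ := exists_functionFieldAlgorithm_decomp_empty.{u}
  ⟨A⟩

end Literature.AnabelianGeometry.AbsoluteAnabelian.AbsTopIII

end
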